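import Summits.KontsevichZagierPeriods.KontsevichZagierPeriods.Theses.TorsionLogs
import Summits.KontsevichZagierPeriods.KontsevichZagierPeriods.Theorems.HyperbolicBlochOffTetraSectorKernelRungZeroLogRelations
import Summits.KontsevichZagierPeriods.KontsevichZagierPeriods.Theorems.TorsionLogsNeronTorsionSectorStubParametersAlgebraic

/-!
# Crux `TorsionLogs.NeronTorsionPrimitiveChain` (stmt-KontsevichZagierPeriods-17981) — birth skeleton, line `inner-nl`

`NeronTorsionPrimitiveChain` is piece X₁ of the strategist's BC2-redirect split of `NeronTorsionSector`
(stmt-14500): for the crux's curve/torsion data and `ρ = 1/2 − a/N = p/q` in lowest terms, the primitive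
tied element `q²•[rI] + p²•[rP]` is a chain of KZ moves to `c•[1 < t < B, dt/t]`, `B > 1` real algebraic.
This skeleton cuts it BY STAGE (the lead's skeleton on the parent, `Cruxes/NeronTorsionSector/Lines/birth.lean`
v2, cuts it BY TOOL — real dictionary, rep constructors, product change of variables, fibre Newton–Leibniz,
dlog unfolding — and keeps the whole chain in one stub `stub_assembly` = this crux verbatim):

* `stub_innerNL` (size M–L, self-contained, worker-sized): ONE Newton–Leibniz move in the INNER variable
  turns the crux's iterated representation `rI = [e₁ < x′ < x < x_P, x′ dx′ dx/(√f(x′)√f(x))]` into a standard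
  log carrier minus the REGULAR second-kind representation `rH = [T, h(x′) dx′ dx/(√f(x)√f(x′))]`,
  `h(x′) = (g₂x′ + 2g₃)/(4x′²)`: indeed `x′/√f(x′) + h(x′)/√f(x′) = d/dx′ (√f(x′)/(2x′))` (as
  `x′f′(x′) − 2f(x′) = 4x′³ + g₂x′ + 2g₃`), the primitive `F(x, x′) = √f(x′)/(2x′√f(x))` is
  `ℚ`-semialgebraic, continuous on the closed fibre `[e₁, x]` and vanishes at `x′ = e₁`, so rule (3) gives
  `[T, (x′ + h)/(√f√f′)] ≡ [(e₁, x_P), dx/(2x)]`, and `x = e₁t²` (rule (2)) gives `[(1, √(x_P/e₁)), dt/t]`.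
  Stated with a free integer `c₀` and any algebraic `B₀ > 1` (the natural witness is `c₀ = 1`,
  `B₀ = √(x_P/e₁)`), and EXISTENTIALLY in `rH` (its existence is part of the claim: `h` is bounded on
  `[e₁, x_P]` because `e₁ > 0`, and `1/(√f√f′)` is integrable on `T` because `rI` is).
* `stub_hChain` (size XL, the mechanism): on the regular density the torsion-translation chain closes with
  INTEGER coefficients: `p²•[rP] − q²•[rH] ≡ c₁•[1 < t < B₁, dt/t]`. This is where the lead's analysis
  lives (grid `x_k = X(kω/n)`, translation cocycle `h∘τ − h = dQ̃`, `Q̃(u+δ) − Q̃(u) = d log ĝ`, integer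
  elimination with `n` even); by soundness its value content is the Néron–torsion identity MINUS the
  elementary `q² log √(x_P/e₁)`.
* Composition `NeronTorsionPrimitiveChain_of_stubs` (real proof): algebraicity of `g₂, g₃, e₁, x_P` from the
  LANDED block `stub_parametersAlgebraic` (Theorems/TorsionLogsNeronTorsionSectorStubParametersAlgebraic.lean);
  `q²•[rI] + p²•[rP] = q²•([rI] + [rH] − c₀[rB₀]) + (p²[rP] − q²[rH] − c₁[rB₁]) + (q²c₀[rB₀] + c₁[rB₁])`;
  the last bracket is ONE carrier `c•[1 < t < B]` by the landed rung-0 log calculus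
  (`interval_log_relation_mem_relations`) applied to `Θ = B₀^{q²c₀}·B₁^{c₁}` (`B = Θ`, `Θ⁻¹` or `2`
  according as `Θ > 1`, `< 1`, `= 1`; carrier from `exists_logRep`).

Why this cut dodges the stuck point of a direct attack: the parent crux's iterated integrand `x′/√f(x′)` has a
POLE-TYPE growth at infinity in the `u`-plane (`℘`), so no translation acts on it by a change of variables;
`h = (g₂x + 2g₃)/(4x²)` is regular on the whole real component (`x ≥ e₁ > 0`) — every later move is on
bounded semialgebraic integrands. `stub_innerNL` isolates exactly this normalisation as a provable-now lemma.

Stubs (sorries only here): `stub_innerNL`, `stub_hChain`. Composition: `NeronTorsionPrimitiveChain_of`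
(kernel-checked, concludes the crux BY NAME). [cite: KontsevichZagier2001, §1.2] [cite: Lang1983, Ch. 13 Thm 1.1]
-/

noncomputable section

open Set MeasureTheory
open Literature.NumberTheory.Transcendental Literature.ModelTheory.ExponentialFields
open Summit.KontsevichZagierPeriods.KontsevichZagierPeriods.Theses.TorsionLogs (NeronTorsionPrimitiveChain)
open Summit.KontsevichZagierPeriods.HyperbolicBloch.OffTetraSectorKernel (exists_logRep
  interval_log_relation_mem_relations)
open Summit.KontsevichZagierPeriods.KontsevichZagierPeriods.Cruxes.NeronTorsionSector.Translation
  (stub_parametersAlgebraic)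

-- `Summit.KontsevichZagierPeriods.KontsevichZagierPeriods.…` is the tree's mandated layout (single-conjunct summit).
set_option linter.dupNamespace false

namespace Summit.KontsevichZagierPeriods.KontsevichZagierPeriods.Cruxes.NeronTorsionPrimitiveChain.InnerNL

/-! ### Stubs -/

/-- **STUB 1 (`stub_innerNL`, size M–L) — Newton–Leibniz in the inner variable.** For a real cubic
`f = 4x³ − g₂x − g₃` (algebraic coefficients, `g₂³ ≠ 27g₃²`) with largest root `e₁ > 0` (`f(e₁) = 0`,
`f > 0` beyond) and algebraic `x_P > e₁`, and ANY representation `rI` of the crux's iterated shape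
`[T = {e₁ < x′ < x < x_P}, x′/(√f(x′)√f(x))]`, there are a representation `rH = [T, h(x′)/(√f(x)√f(x′))]`
with the regular second-kind density `h(x′) = (g₂x′ + 2g₃)/(4x′²)`, an integer `c₀`, a real algebraic
`B₀ > 1` and a log carrier `rB₀ = [1 < t < B₀, dt/t]` with `[rI] + [rH] − c₀•[rB₀] ∈ KZ.relations`.
Route: `x′/√f + h/√f = ∂_{x′}(√f(x′)/(2x′))`; rule (3) along the last coordinate of the band `T` over
`(e₁, x_P)` with the `ℚ`-semialgebraic primitive `F(x,x′) = √f(x′)/(2x′√f(x))` (continuous on `[e₁, x]`,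
`F(x, e₁) = 0`, `F(x, x) = 1/(2x)`) after one integrand-additivity move (1b); then rule (2) along
`x = e₁t²` onto `[(1, √(x_P/e₁)), dt/t]` (`c₀ = 1`). Leans on `KZ.newtonLeibnizRel`, `KZ.integrandAddRel`,
`KZ.changeOfVariablesRel`, `exists_logRep`, semialgebraic closure rules (`IsSemialgebraicFunOn.sqrt_holds`,
`.div`, `.mul_holds`). [cite: KontsevichZagier2001, §1.2 rules (1)–(3)] -/
theorem stub_innerNL :
    ∀ (g₂ g₃ e₁ xP : ℝ) (f : ℝ → ℝ),
    IsAlgebraic ℚ g₂ → IsAlgebraic ℚ g₃ → IsAlgebraic ℚ e₁ → IsAlgebraic ℚ xP →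
    (∀ x, f x = 4 * x ^ 3 - g₂ * x - g₃) → g₂ ^ 3 - 27 * g₃ ^ 2 ≠ 0 → f e₁ = 0 → 0 < e₁ →
    (∀ x, e₁ < x → 0 < f x) → e₁ < xP →
    ∀ (rI : Literature.NumberTheory.Transcendental.KZ.IntegralRep 2),
    rI.domain = {z | e₁ < z 1 ∧ z 1 < z 0 ∧ z 0 < xP} →
    Set.EqOn rI.integrand (fun z => z 1 / (Real.sqrt (f (z 1)) * Real.sqrt (f (z 0)))) rI.domain →
    ∃ (rH : Literature.NumberTheory.Transcendental.KZ.IntegralRep 2) (c₀ : ℤ) (B₀ : ℝ)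
      (rB₀ : Literature.NumberTheory.Transcendental.KZ.IntegralRep 1),
      rH.domain = {z | e₁ < z 1 ∧ z 1 < z 0 ∧ z 0 < xP} ∧
      Set.EqOn rH.integrand
        (fun z => (Real.sqrt (f (z 0)))⁻¹ * ((g₂ * z 1 + 2 * g₃) / (4 * (z 1) ^ 2 * Real.sqrt (f (z 1)))))
        rH.domain ∧
      1 < B₀ ∧ IsAlgebraic ℚ B₀ ∧ rB₀.domain = {t | 1 < t 0 ∧ t 0 < B₀} ∧
      Set.EqOn rB₀.integrand (fun t => (t 0)⁻¹) rB₀.domain ∧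
      Literature.NumberTheory.Transcendental.KZ.of rI + Literature.NumberTheory.Transcendental.KZ.of rH -
          c₀ • Literature.NumberTheory.Transcendental.KZ.of rB₀ ∈
        Literature.NumberTheory.Transcendental.KZ.relations := by
  sorry

/-- **STUB 2 (`stub_hChain`, size XL, the mechanism) — the torsion chain on the REGULAR density.** For
the crux's curve/torsion data (`P = (x_P, y_P)` of exact order `N ≥ 3` on the identity component,
`N·∫_(x_P)^∞ dx/√f = a·ω₁`, `0 < 2a < N`, `ρ = p/q` lowest terms with `q(N − 2a) = 2Np`; parameters
algebraic) and ANY representations `rH = [T, h(x′)/(√f(x)√f(x′))]` (`h = (g₂x′ + 2g₃)/(4x′²)`) and `rP` of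
the crux's product shape (value `η₁ω₁/2`; its integrand is `2h(x′)/(√f√f′)` on `(e₁, ∞)²`), there are
`c₁ ∈ ℤ`, a real algebraic `B₁ > 1` and a carrier `rB₁ = [1 < t < B₁, dt/t]` with
`p²•[rP] − q²•[rH] − c₁•[rB₁] ∈ KZ.relations`. By soundness its value content is
`p²η₁ω₁/2 + q²I − q² log √(x_P/e₁) = q²(log α_P − log √(x_P/e₁))` (Néron–torsion identity, Lang 1983
Ch. 13 Thm 1.1 — classical; here to be realised by MOVES, no value hypothesis). Intended proof = the lead's
translation-only chain (parent skeleton v2: `u`-translations free by `stub_productCoV`, `v`-translations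
cost the cocycle `Q̃` via `stub_fibreNL`, consecutive `θ̃`'s differ by `∫ dlog ĝ` unfolded by
`stub_dlogUnfold`, wrap-around by torsion `nδ = ω`, integer elimination with `n` even), run on `rH`, `rP`
directly. Why it might fail: a non-semialgebraic cocycle on some cell, or an odd residual coefficient (then
only `d•(…)` lands and saturation is conjecture-strength). [cite: Lang1983, Ch. 13 Thm 1.1]
[cite: KontsevichZagier2001, §1.2] -/
theorem stub_hChain :
    ∀ (g₂ g₃ e₁ xP yP : ℝ) (N a p q : ℕ) (f : ℝ → ℝ),
    IsAlgebraic ℚ g₂ → IsAlgebraic ℚ g₃ → IsAlgebraic ℚ e₁ → IsAlgebraic ℚ xP →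
    (∀ x, f x = 4 * x ^ 3 - g₂ * x - g₃) → g₂ ^ 3 - 27 * g₃ ^ 2 ≠ 0 → f e₁ = 0 → 0 < e₁ →
    (∀ x, e₁ < x → 0 < f x) → e₁ < xP → yP ^ 2 = f xP → 3 ≤ N → 0 < a → 2 * a < N →
    (∀ hns : (⟨0, 0, 0, -g₂ / 4, -g₃ / 4⟩ : WeierstrassCurve ℝ).toAffine.Nonsingular xP (yP / 2),
    addOrderOf (WeierstrassCurve.Affine.Point.some xP (yP / 2) hns) = N) →
    (N : ℝ) * (∫ x in Set.Ioi xP, (Real.sqrt (f x))⁻¹) = a * (2 * ∫ x in Set.Ioi e₁, (Real.sqrt (f x))⁻¹) →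
    Nat.Coprime p q → (q : ℤ) * ((N : ℤ) - 2 * (a : ℤ)) = (p : ℤ) * (2 * (N : ℤ)) →
    ∀ (rH rP : Literature.NumberTheory.Transcendental.KZ.IntegralRep 2),
    rH.domain = {z | e₁ < z 1 ∧ z 1 < z 0 ∧ z 0 < xP} →
    Set.EqOn rH.integrand
      (fun z => (Real.sqrt (f (z 0)))⁻¹ * ((g₂ * z 1 + 2 * g₃) / (4 * (z 1) ^ 2 * Real.sqrt (f (z 1)))))
      rH.domain →
    rP.domain = {z | e₁ < z 0 ∧ e₁ < z 1} →
    Set.EqOn rP.integrand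
      (fun z => (Real.sqrt (f (z 0)))⁻¹ * ((g₂ * z 1 + 2 * g₃) / (2 * (z 1) ^ 2 * Real.sqrt (f (z 1))))) rP.domain →
    ∃ (c₁ : ℤ) (B₁ : ℝ) (rB₁ : Literature.NumberTheory.Transcendental.KZ.IntegralRep 1),
      1 < B₁ ∧ IsAlgebraic ℚ B₁ ∧ rB₁.domain = {t | 1 < t 0 ∧ t 0 < B₁} ∧
      Set.EqOn rB₁.integrand (fun t => (t 0)⁻¹) rB₁.domain ∧
      ((p : ℤ) ^ 2) • Literature.NumberTheory.Transcendental.KZ.of rP -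
          ((q : ℤ) ^ 2) • Literature.NumberTheory.Transcendental.KZ.of rH -
          c₁ • Literature.NumberTheory.Transcendental.KZ.of rB₁ ∈
        Literature.NumberTheory.Transcendental.KZ.relations := by
  sorry

/-! ### Landed-grade bookkeeping (real proofs, no `sorry` below this line) -/

/-- Integer powers of real algebraic numbers are algebraic. [folklore] -/
theorem isAlgebraic_zpow {x : ℝ} (hx : IsAlgebraic ℚ x) (n : ℤ) : IsAlgebraic ℚ (x ^ n) := by
  obtain ⟨k, rfl | rfl⟩ := Int.eq_nat_or_neg n
  · simpa using hx.pow k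
  · simpa [zpow_neg] using (hx.pow k).inv

/-- **Merging two log carriers into one** by the landed rung-`0` log calculus: for integers `u, v`, real
algebraic `B₀, B₁ > 1` with carriers `rB₀, rB₁`, there are `c ∈ ℤ`, a real algebraic `B > 1` and a carrier
`rB` with `u•[rB₀] + v•[rB₁] − c•[rB] ∈ KZ.relations` (`Θ = B₀^u B₁^v`; `B = Θ, Θ⁻¹, 2` as `Θ >, <, = 1`).
[cite: Goncharov1999, §1.7] -/
theorem merge_two_logs (u v : ℤ) {B₀ B₁ : ℝ} (hB₀ : 1 < B₀) (hB₁ : 1 < B₁)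
    (hB₀alg : IsAlgebraic ℚ B₀) (hB₁alg : IsAlgebraic ℚ B₁)
    (rB₀ rB₁ : Literature.NumberTheory.Transcendental.KZ.IntegralRep 1)
    (hd₀ : rB₀.domain = {t | 1 < t 0 ∧ t 0 < B₀}) (hi₀ : Set.EqOn rB₀.integrand (fun t => (t 0)⁻¹) rB₀.domain)
    (hd₁ : rB₁.domain = {t | 1 < t 0 ∧ t 0 < B₁}) (hi₁ : Set.EqOn rB₁.integrand (fun t => (t 0)⁻¹) rB₁.domain) :
    ∃ (c : ℤ) (B : ℝ) (rB : Literature.NumberTheory.Transcendental.KZ.IntegralRep 1),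
      1 < B ∧ IsAlgebraic ℚ B ∧ rB.domain = {t | 1 < t 0 ∧ t 0 < B} ∧
      Set.EqOn rB.integrand (fun t => (t 0)⁻¹) rB.domain ∧
      u • KZ.of rB₀ + v • KZ.of rB₁ - c • KZ.of rB ∈ KZ.relations := by
  have hB₀0 : 0 < B₀ := by linarith
  have hB₁0 : 0 < B₁ := by linarith
  set Θ : ℝ := B₀ ^ u * B₁ ^ v with hΘ
  have hΘ0 : 0 < Θ := mul_pos (zpow_pos hB₀0 _) (zpow_pos hB₁0 _)
  have hΘalg : IsAlgebraic ℚ Θ := (isAlgebraic_zpow hB₀alg u).mul (isAlgebraic_zpow hB₁alg v)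
  have hlogΘ : Real.log Θ = (u : ℝ) * Real.log B₀ + (v : ℝ) * Real.log B₁ := by
    rw [hΘ, Real.log_mul (zpow_pos hB₀0 _).ne' (zpow_pos hB₁0 _).ne', Real.log_zpow, Real.log_zpow]
  -- choose the target carrier's end point and coefficient
  obtain ⟨c, B, hB, hBalg, hcB⟩ :
      ∃ (c : ℤ) (B : ℝ), 1 < B ∧ IsAlgebraic ℚ B ∧ (c : ℝ) * Real.log B = Real.log Θ := by
    rcases lt_trichotomy Θ 1 with hlt | heq | hgt
    · refine ⟨-1, Θ⁻¹, (one_lt_inv₀ hΘ0).mpr hlt, hΘalg.inv, ?_⟩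
      rw [Real.log_inv]
      push_cast
      ring
    · refine ⟨0, 2, one_lt_two, ?_, ?_⟩
      · exact_mod_cast isAlgebraic_nat (R := ℚ) (A := ℝ) 2
      · rw [heq, Real.log_one]
        push_cast
        ring
    · exact ⟨1, Θ, hgt, hΘalg, by push_cast; ring⟩
  obtain ⟨rB, hdB, hiB⟩ := exists_logRep (a := (1 : ℝ)) (b := B) one_pos isAlgebraic_one hBalg
  have hiB' : Set.EqOn rB.integrand (fun t => (t 0)⁻¹) rB.domain := fun t _ => by
    rw [hiB]
    simp only [one_div]
  refine ⟨c, B, rB, hB, hBalg, hdB, hiB', ?_⟩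
  -- the landed log calculus on the three carriers
  have hi₀' : Set.EqOn rB₀.integrand (fun t : Fin 1 → ℝ => 1 / t 0) rB₀.domain := fun t ht => by
    simp only [hi₀ ht, one_div]
  have hi₁' : Set.EqOn rB₁.integrand (fun t : Fin 1 → ℝ => 1 / t 0) rB₁.domain := fun t ht => by
    simp only [hi₁ ht, one_div]
  have hiB1 : Set.EqOn rB.integrand (fun t : Fin 1 → ℝ => 1 / t 0) rB.domain := fun t _ => by rw [hiB]
  have h := interval_log_relation_mem_relations 3 ![1, 1, 1] ![B₀, B₁, B] ![u, v, -c] ![rB₀, rB₁, rB]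
    (fun i => by fin_cases i <;> simp)
    (fun i => by fin_cases i <;> simp [hB₀.le, hB₁.le, hB.le])
    (fun i => by fin_cases i <;> exact isAlgebraic_one)
    (fun i => by fin_cases i <;> simp [hB₀alg, hB₁alg, hBalg])
    (fun i => by
      fin_cases i
      · exact ⟨hd₀, hi₀'⟩
      · exact ⟨hd₁, hi₁'⟩
      · exact ⟨hdB, hiB1⟩)
    (by
      simp only [Fin.sum_univ_three, Matrix.cons_val_zero, Matrix.cons_val_one, Matrix.cons_val_two,
        Matrix.head_cons, Matrix.tail_cons, div_one, Int.cast_neg]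
      linear_combination -hlogΘ - hcB)
  have e : ∑ i : Fin 3, (![u, v, -c] i : ℤ) • KZ.of (![rB₀, rB₁, rB] i) =
      u • KZ.of rB₀ + v • KZ.of rB₁ - c • KZ.of rB := by
    simp only [Fin.sum_univ_three, Matrix.cons_val_zero, Matrix.cons_val_one, Matrix.cons_val_two,
      Matrix.head_cons, Matrix.tail_cons, neg_smul]
    abel
  rw [e] at h
  exact h

/-- **The crux from the two stubs (real proof).** Algebraicity of the parameters from the landed block
`stub_parametersAlgebraic`; `stub_innerNL` on `rI`, `stub_hChain` on the produced `rH` and the given `rP`;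
`q²[rI] + p²[rP] = q²([rI] + [rH] − c₀[rB₀]) + (p²[rP] − q²[rH] − c₁[rB₁]) + (q²c₀[rB₀] + c₁[rB₁])` and the
last bracket is one carrier by `merge_two_logs`. [cite: KontsevichZagier2001, §1.2] -/
theorem NeronTorsionPrimitiveChain_of_stubs
    (h₁ : ∀ (g₂ g₃ e₁ xP : ℝ) (f : ℝ → ℝ),
      IsAlgebraic ℚ g₂ → IsAlgebraic ℚ g₃ → IsAlgebraic ℚ e₁ → IsAlgebraic ℚ xP →
      (∀ x, f x = 4 * x ^ 3 - g₂ * x - g₃) → g₂ ^ 3 - 27 * g₃ ^ 2 ≠ 0 → f e₁ = 0 → 0 < e₁ →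
      (∀ x, e₁ < x → 0 < f x) → e₁ < xP →
      ∀ (rI : Literature.NumberTheory.Transcendental.KZ.IntegralRep 2),
      rI.domain = {z | e₁ < z 1 ∧ z 1 < z 0 ∧ z 0 < xP} →
      Set.EqOn rI.integrand (fun z => z 1 / (Real.sqrt (f (z 1)) * Real.sqrt (f (z 0)))) rI.domain →
      ∃ (rH : Literature.NumberTheory.Transcendental.KZ.IntegralRep 2) (c₀ : ℤ) (B₀ : ℝ)
        (rB₀ : Literature.NumberTheory.Transcendental.KZ.IntegralRep 1),
        rH.domain = {z | e₁ < z 1 ∧ z 1 < z 0 ∧ z 0 < xP} ∧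
        Set.EqOn rH.integrand
          (fun z => (Real.sqrt (f (z 0)))⁻¹ * ((g₂ * z 1 + 2 * g₃) / (4 * (z 1) ^ 2 * Real.sqrt (f (z 1)))))
          rH.domain ∧
        1 < B₀ ∧ IsAlgebraic ℚ B₀ ∧ rB₀.domain = {t | 1 < t 0 ∧ t 0 < B₀} ∧
        Set.EqOn rB₀.integrand (fun t => (t 0)⁻¹) rB₀.domain ∧
        Literature.NumberTheory.Transcendental.KZ.of rI + Literature.NumberTheory.Transcendental.KZ.of rH -
            c₀ • Literature.NumberTheory.Transcendental.KZ.of rB₀ ∈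
          Literature.NumberTheory.Transcendental.KZ.relations)
    (h₂ : ∀ (g₂ g₃ e₁ xP yP : ℝ) (N a p q : ℕ) (f : ℝ → ℝ),
      IsAlgebraic ℚ g₂ → IsAlgebraic ℚ g₃ → IsAlgebraic ℚ e₁ → IsAlgebraic ℚ xP →
      (∀ x, f x = 4 * x ^ 3 - g₂ * x - g₃) → g₂ ^ 3 - 27 * g₃ ^ 2 ≠ 0 → f e₁ = 0 → 0 < e₁ →
      (∀ x, e₁ < x → 0 < f x) → e₁ < xP → yP ^ 2 = f xP → 3 ≤ N → 0 < a → 2 * a < N →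
      (∀ hns : (⟨0, 0, 0, -g₂ / 4, -g₃ / 4⟩ : WeierstrassCurve ℝ).toAffine.Nonsingular xP (yP / 2),
      addOrderOf (WeierstrassCurve.Affine.Point.some xP (yP / 2) hns) = N) →
      (N : ℝ) * (∫ x in Set.Ioi xP, (Real.sqrt (f x))⁻¹) = a * (2 * ∫ x in Set.Ioi e₁, (Real.sqrt (f x))⁻¹) →
      Nat.Coprime p q → (q : ℤ) * ((N : ℤ) - 2 * (a : ℤ)) = (p : ℤ) * (2 * (N : ℤ)) →
      ∀ (rH rP : Literature.NumberTheory.Transcendental.KZ.IntegralRep 2),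
      rH.domain = {z | e₁ < z 1 ∧ z 1 < z 0 ∧ z 0 < xP} →
      Set.EqOn rH.integrand
        (fun z => (Real.sqrt (f (z 0)))⁻¹ * ((g₂ * z 1 + 2 * g₃) / (4 * (z 1) ^ 2 * Real.sqrt (f (z 1)))))
        rH.domain →
      rP.domain = {z | e₁ < z 0 ∧ e₁ < z 1} →
      Set.EqOn rP.integrand
        (fun z => (Real.sqrt (f (z 0)))⁻¹ * ((g₂ * z 1 + 2 * g₃) / (2 * (z 1) ^ 2 * Real.sqrt (f (z 1))))) rP.domain →
      ∃ (c₁ : ℤ) (B₁ : ℝ) (rB₁ : Literature.NumberTheory.Transcendental.KZ.IntegralRep 1),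
        1 < B₁ ∧ IsAlgebraic ℚ B₁ ∧ rB₁.domain = {t | 1 < t 0 ∧ t 0 < B₁} ∧
        Set.EqOn rB₁.integrand (fun t => (t 0)⁻¹) rB₁.domain ∧
        ((p : ℤ) ^ 2) • Literature.NumberTheory.Transcendental.KZ.of rP -
            ((q : ℤ) ^ 2) • Literature.NumberTheory.Transcendental.KZ.of rH -
            c₁ • Literature.NumberTheory.Transcendental.KZ.of rB₁ ∈
          Literature.NumberTheory.Transcendental.KZ.relations) :
    NeronTorsionPrimitiveChain := by
  intro g₂ g₃ e₁ xP yP N a p q f hf hdisc he he0 hpos hx hy hN ha ha2 htor hρ hcop hpq rI rP hdI hiI hdP hiP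
  -- algebraicity of the parameters is forced by the existence of `rI` (landed block S2 of the parent line)
  obtain ⟨hg₂, hg₃, he₁, hxP⟩ :=
    stub_parametersAlgebraic g₂ g₃ e₁ xP f hf he he0 hpos hx rI rP hdI hiI hdP hiP
  -- stage 1: Newton–Leibniz in the inner variable
  obtain ⟨rH, c₀, B₀, rB₀, hdH, hiH, hB₀, hB₀alg, hdB₀, hiB₀, hrel₁⟩ :=
    h₁ g₂ g₃ e₁ xP f hg₂ hg₃ he₁ hxP hf hdisc he he0 hpos hx rI hdI hiI
  -- stage 2: the chain on the regular density
  obtain ⟨c₁, B₁, rB₁, hB₁, hB₁alg, hdB₁, hiB₁, hrel₂⟩ :=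
    h₂ g₂ g₃ e₁ xP yP N a p q f hg₂ hg₃ he₁ hxP hf hdisc he he0 hpos hx hy hN ha ha2 htor hρ hcop hpq rH rP
      hdH hiH hdP hiP
  -- stage 3: merge the two carriers
  obtain ⟨c, B, rB, hB, hBalg, hdB, hiB, hrel₃⟩ :=
    merge_two_logs ((q : ℤ) ^ 2 * c₀) c₁ hB₀ hB₁ hB₀alg hB₁alg rB₀ rB₁ hdB₀ hiB₀ hdB₁ hiB₁
  refine ⟨c, B, rB, hB, hBalg, hdB, hiB, ?_⟩
  have e : ((q : ℤ) ^ 2) • KZ.of rI + ((p : ℤ) ^ 2) • KZ.of rP - c • KZ.of rB =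
      ((q : ℤ) ^ 2) • (KZ.of rI + KZ.of rH - c₀ • KZ.of rB₀) +
        (((p : ℤ) ^ 2) • KZ.of rP - ((q : ℤ) ^ 2) • KZ.of rH - c₁ • KZ.of rB₁) +
        (((q : ℤ) ^ 2 * c₀) • KZ.of rB₀ + c₁ • KZ.of rB₁ - c • KZ.of rB) := by
    module
  rw [e]
  exact KZ.relations.add_mem (KZ.relations.add_mem (KZ.relations.zsmul_mem hrel₁ _) hrel₂) hrel₃

/-- **Composition (kernel-checked): the crux BY NAME from the two stubs.** The only `sorry`s of this file are
inside `stub_innerNL` and `stub_hChain`. [cite: KontsevichZagier2001, §1.2] -/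
theorem NeronTorsionPrimitiveChain_of : NeronTorsionPrimitiveChain :=
  NeronTorsionPrimitiveChain_of_stubs stub_innerNL stub_hChain

end Summit.KontsevichZagierPeriods.KontsevichZagierPeriods.Cruxes.NeronTorsionPrimitiveChain.InnerNL
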